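import Summits.NavierStokesRegularity.NavierStokesRegularity.Theorems.CircuitPump.Negative.LoadBearing
import Literature.Analysis.ODE.LinearComparison

/-!
# Structure of truncated Toda solutions: bond positivity and one-way energy flux
# (crux `PerpetualPump.CircuitPump`, stmt-NavierStokesRegularity-1834;
# line `singular-clock-gspt`, sub-goal `toda_trunc_structure` of `stub_clockBox`)

The `L`-truncated seeded graded Toda lattice (carrier `a n`, bond `b n`, `n ∈ ℤ`; modes with
`|n| > L` read as `0` on `[0, T]`; `lam > 0`, `ε ≥ 0`):
`ȧ_n = -lam^{4n/5} a_n - lamⁿ b_n² + lam^{n-1} b_{n-1}² - ε lamⁿ a_n b_n`,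
`ḃ_n = -lam^{4n/5} b_n + lamⁿ b_n (a_n - a_{n+1}) + ε lamⁿ a_n²` (`|n| ≤ L`, right derivatives
on `[0, T)`). Two structural facts (`toda_trunc_structure`):

* (i) bond positivity is forward invariant: `ḃ_n = c_n(t) b_n + ε lamⁿ a_n² ≥ c_n(t) b_n` with
  `c_n` continuous, so `b_n(t) ≥ b_n(0) e^{∫ c_n} ≥ 0` (tree `linearComparison_le`);
* (ii) one-way energy flux: `d/dt (a_n² + b_n²) = -2 lam^{4n/5} (a_n² + b_n²) + F_n - F_{n+1}`,
  `F_n = 2 lam^{n-1} b_{n-1}² a_n` (the same-scale bond and the seed are energy neutral), the flux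
  telescopes over the block `k ≤ n ≤ L` with `F_{L+1} = 0`, and dropping the damping gives
  `E_k(t) ≤ E_k(0) + 2 lam^{k-1} ∫₀ᵗ b_{k-1}² |a_k|` (tree `le_add_integral_of_deriv_right_le`).
[folklore]
-/

noncomputable section

-- the summit namespace `…NavierStokesRegularity.NavierStokesRegularity…` is the tree convention
set_option linter.dupNamespace false

namespace Summit.NavierStokesRegularity.NavierStokesRegularity.Theorems.PerpetualPumpCircuitPump

open Set Filter Topology
open Literature.Analysis.ODE

/-- Telescoping over an integer interval written as `[k, k + m - 1]`:
`∑_{n=k}^{k+m-1} (F n - F (n+1)) = F k - F (k+m)`. [folklore] -/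
theorem sum_Icc_sub_succ_telescope (F : ℤ → ℝ) (k : ℤ) (m : ℕ) :
    ∑ n ∈ Finset.Icc k (k + m - 1), (F n - F (n + 1)) = F k - F (k + m) := by
  induction m with
  | zero =>
    have h : Finset.Icc k (k + ((0 : ℕ) : ℤ) - 1) = ∅ := by
      ext n; simp only [Finset.mem_Icc, Finset.notMem_empty, iff_false]; push_cast; omega
    rw [h, Finset.sum_empty]; push_cast; ring
  | succ m ih =>
    have hins : Finset.Icc k (k + ((m + 1 : ℕ) : ℤ) - 1) =
        insert (k + m) (Finset.Icc k (k + (m : ℤ) - 1)) := by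
      ext n; simp only [Finset.mem_insert, Finset.mem_Icc]; push_cast; omega
    have hnot : (k + m) ∉ Finset.Icc k (k + (m : ℤ) - 1) := by
      simp only [Finset.mem_Icc]; omega
    rw [hins, Finset.sum_insert hnot, ih]; push_cast; ring

/-- Telescoping over an integer interval: `∑_{n=k}^{M} (F n - F (n+1)) = F k - F (M+1)` for
`k ≤ M + 1` (empty sum when `k = M + 1`). [folklore] -/
theorem sum_Icc_sub_telescope (F : ℤ → ℝ) {k M : ℤ} (h : k ≤ M + 1) :
    ∑ n ∈ Finset.Icc k M, (F n - F (n + 1)) = F k - F (M + 1) := by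
  obtain ⟨m, hm⟩ : ∃ m : ℕ, M = k + m - 1 := ⟨(M + 1 - k).toNat, by omega⟩
  subst hm
  rw [sum_Icc_sub_succ_telescope, sub_add_cancel]

/-- **Structure of truncated Toda solutions: bond positivity and one-way energy flux.** For the
`L`-truncated seeded Toda circuit (carrier `a n`, bond `b n`, scales `|n| ≤ L`, modes beyond `L` read as `0`;
`lam > 0`, `ε ≥ 0`) on `[0,T]`: (i) non-negative bonds stay non-negative (`ḃ_n = b_n·(…) + ε lamⁿ a_n² ≥ b_n·(…)`);
(ii) the quadratic part conserves `Σ(a_n² + b_n²)` triple by triple and the only coupling of the block `{n ≥ k}` to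
`{n < k}` is the bond `(b_{k−1}, b_{k−1}, a_k)`, which feeds the block at rate `2 lam^{k−1} b_{k−1}² a_k`; dropping
the (negative) damping gives the partial-energy bound `E_k(t) ≤ E_k(0) + 2 lam^{k−1} ∫₀ᵗ b_{k−1}² |a_k|`,
`E_k = Σ_{n=k}^{L} (a_n² + b_n²)`. [folklore] -/
theorem toda_trunc_structure :
    ∀ (lam ε T : ℝ) (L : ℕ) (a b : ℤ → ℝ → ℝ), 0 < lam → 0 ≤ ε → 0 < T →
    (∀ n : ℤ, (L : ℤ) < |n| → ∀ t ∈ Set.Icc 0 T, a n t = 0 ∧ b n t = 0) →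
    (∀ n : ℤ, |n| ≤ (L : ℤ) → ContinuousOn (a n) (Set.Icc 0 T) ∧ ContinuousOn (b n) (Set.Icc 0 T)) →
    (∀ n : ℤ, |n| ≤ (L : ℤ) → ∀ t ∈ Set.Ico 0 T,
      HasDerivWithinAt (a n)
        (-(lam ^ ((4 / 5 : ℝ) * n)) * a n t - lam ^ (n : ℝ) * b n t ^ 2 +
          lam ^ ((n : ℝ) - 1) * b (n - 1) t ^ 2 - ε * lam ^ (n : ℝ) * a n t * b n t) (Set.Ici t) t ∧
      HasDerivWithinAt (b n)
        (-(lam ^ ((4 / 5 : ℝ) * n)) * b n t + lam ^ (n : ℝ) * b n t * (a n t - a (n + 1) t) +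
          ε * lam ^ (n : ℝ) * a n t ^ 2) (Set.Ici t) t) →
    (∀ n : ℤ, 0 ≤ b n 0) →
    (∀ n : ℤ, ∀ t ∈ Set.Icc 0 T, 0 ≤ b n t) ∧
    (∀ k : ℤ, ∀ t ∈ Set.Icc 0 T,
      (∑ n ∈ Finset.Icc k (L : ℤ), (a n t ^ 2 + b n t ^ 2)) ≤
        (∑ n ∈ Finset.Icc k (L : ℤ), (a n 0 ^ 2 + b n 0 ^ 2)) +
          2 * lam ^ ((k : ℝ) - 1) * ∫ τ in (0 : ℝ)..t, b (k - 1) τ ^ 2 * |a k τ|) := by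
  intro lam ε T L a b hlam hε _hT hzero hcont hode hb0
  -- every mode is continuous on `[0, T]` (modes beyond `L` vanish identically there)
  have hall : ∀ n : ℤ, ContinuousOn (a n) (Icc 0 T) ∧ ContinuousOn (b n) (Icc 0 T) := by
    intro n
    rcases le_or_gt |n| (L : ℤ) with hn | hn
    · exact hcont n hn
    · exact ⟨(continuousOn_const (c := (0 : ℝ))).congr fun s hs => (hzero n hn s hs).1,
        (continuousOn_const (c := (0 : ℝ))).congr fun s hs => (hzero n hn s hs).2⟩
  refine ⟨?_, ?_⟩
  · -- (i) bond positivity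
    intro n t ht
    rcases le_or_gt |n| (L : ℤ) with hn | hn
    · have hβc : ContinuousOn
          (fun s => -(lam ^ ((4 / 5 : ℝ) * n)) + lam ^ (n : ℝ) * (a n s - a (n + 1) s)) (Icc 0 T) :=
        continuousOn_const.add (continuousOn_const.mul ((hall n).1.sub (hall (n + 1)).1))
      have key := linearComparison_le (g := b n) (A := fun _ => 0)
        (g' := fun s => -(lam ^ ((4 / 5 : ℝ) * n)) * b n s + lam ^ (n : ℝ) * b n s *
          (a n s - a (n + 1) s) + ε * lam ^ (n : ℝ) * a n s ^ 2)
        (β := fun s => -(lam ^ ((4 / 5 : ℝ) * n)) + lam ^ (n : ℝ) * (a n s - a (n + 1) s))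
        (hall n).2 (fun s hs => (hode n hn s hs).2) continuousOn_const hβc
        (fun s _ => by
          have h0 : 0 ≤ ε * lam ^ (n : ℝ) * a n s ^ 2 := by positivity
          nlinarith [h0]) ht
      simp only [zero_mul, intervalIntegral.integral_zero, add_zero] at key
      exact le_trans (mul_nonneg (Real.exp_pos _).le (hb0 n)) key
    · exact ((hzero n hn t ht).2).ge
  · -- (ii) one-way energy flux
    intro k t ht
    -- the flux `Φ n = 2 lam^{n-1} b_{n-1}² a_n` entering mode `n` from below
    set Φ : ℤ → ℝ → ℝ := fun n τ => 2 * lam ^ ((n : ℝ) - 1) * b (n - 1) τ ^ 2 * a n τ with hΦ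
    -- per-mode energy identity (same-scale bond and seed are energy neutral)
    have hmode : ∀ n : ℤ, ∀ τ ∈ Ico 0 T, HasDerivWithinAt (fun s => a n s ^ 2 + b n s ^ 2)
        (-2 * lam ^ ((4 / 5 : ℝ) * n) * (a n τ ^ 2 + b n τ ^ 2) + (Φ n τ - Φ (n + 1) τ))
        (Ici τ) τ := by
      intro n τ hτ
      have h1 : ((n + 1 : ℤ) : ℝ) - 1 = (n : ℝ) := by push_cast; ring
      have h2 : n + 1 - 1 = n := by ring
      rcases le_or_gt |n| (L : ℤ) with hn | hn
      · obtain ⟨ha, hb⟩ := hode n hn τ hτ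
        have hd := (ha.mul ha).add (hb.mul hb)
        have heq : (fun s => a n s ^ 2 + b n s ^ 2) = fun s => a n s * a n s + b n s * b n s := by
          funext s; ring
        rw [heq]
        refine hd.congr_deriv ?_
        simp only [hΦ]
        rw [h1, h2]
        ring
      · -- a vanishing mode: the energy is `0` near `τ` within `[τ, ∞)`, and the formula reads `0`
        have hev : (fun s => a n s ^ 2 + b n s ^ 2) =ᶠ[𝓝[Ici τ] τ] fun _ => (0 : ℝ) := by
          filter_upwards [Ico_mem_nhdsGE hτ.2] with s hs
          obtain ⟨has, hbs⟩ := hzero n hn s ⟨hτ.1.trans hs.1, hs.2.le⟩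
          simp [has, hbs]
        obtain ⟨ha0, hb0'⟩ := hzero n hn τ (Ico_subset_Icc_self hτ)
        have h0 : HasDerivWithinAt (fun s => a n s ^ 2 + b n s ^ 2) 0 (Ici τ) τ :=
          (hasDerivWithinAt_const τ (Ici τ) (0 : ℝ)).congr_of_eventuallyEq hev
            (by simp [ha0, hb0'])
        refine h0.congr_deriv ?_
        simp only [hΦ]
        rw [h2, ha0, hb0']
        ring
    -- the block energy, its derivative, and the dominating flux
    set E : ℝ → ℝ := fun τ => ∑ n ∈ Finset.Icc k (L : ℤ), (a n τ ^ 2 + b n τ ^ 2) with hE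
    set E' : ℝ → ℝ := fun τ => ∑ n ∈ Finset.Icc k (L : ℤ),
      (-2 * lam ^ ((4 / 5 : ℝ) * n) * (a n τ ^ 2 + b n τ ^ 2) + (Φ n τ - Φ (n + 1) τ)) with hE'
    set A : ℝ → ℝ := fun τ => 2 * lam ^ ((k : ℝ) - 1) * (b (k - 1) τ ^ 2 * |a k τ|) with hA
    have hEc : ContinuousOn E (Icc 0 T) :=
      continuousOn_finsetSum _ fun n _ => ((hall n).1.pow 2).add ((hall n).2.pow 2)
    have hEd : ∀ τ ∈ Ico 0 T, HasDerivWithinAt E (E' τ) (Ici τ) τ := fun τ hτ =>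
      HasDerivWithinAt.fun_sum fun n _ => hmode n τ hτ
    have hAc : ContinuousOn A (Icc 0 T) :=
      continuousOn_const.mul (((hall (k - 1)).2.pow 2).mul (hall k).1.abs)
    have hbound : ∀ τ ∈ Ico 0 T, E' τ ≤ A τ := by
      intro τ hτ
      have hA0 : Φ k τ ≤ A τ := by
        simp only [hΦ, hA]
        rw [mul_assoc (2 * lam ^ ((k : ℝ) - 1))]
        exact mul_le_mul_of_nonneg_left (mul_le_mul_of_nonneg_left (le_abs_self _) (sq_nonneg _))
          (by positivity)
      have hdamp : ∑ n ∈ Finset.Icc k (L : ℤ),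
          (-2 * lam ^ ((4 / 5 : ℝ) * n) * (a n τ ^ 2 + b n τ ^ 2)) ≤ 0 := by
        refine Finset.sum_nonpos fun n _ => ?_
        have : 0 ≤ 2 * lam ^ ((4 / 5 : ℝ) * n) * (a n τ ^ 2 + b n τ ^ 2) := by positivity
        linarith
      simp only [hE']
      rw [Finset.sum_add_distrib]
      rcases le_or_gt k ((L : ℤ) + 1) with hk | hk
      · have htop : Φ ((L : ℤ) + 1) τ = 0 := by
          have hL : (L : ℤ) < |(L : ℤ) + 1| := lt_of_lt_of_le (by omega) (le_abs_self _)
          simp only [hΦ]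
          rw [(hzero _ hL τ (Ico_subset_Icc_self hτ)).1, mul_zero]
        rw [sum_Icc_sub_telescope (fun n => Φ n τ) hk, htop, sub_zero]
        linarith
      · have hemp : Finset.Icc k (L : ℤ) = ∅ := Finset.Icc_eq_empty_of_lt (by omega)
        rw [hemp, Finset.sum_empty, Finset.sum_empty, add_zero]
        simp only [hA]
        positivity
    have key := le_add_integral_of_deriv_right_le hEc hEd hAc hbound ht
    have hint : ∫ s in (0 : ℝ)..t, A s =
        2 * lam ^ ((k : ℝ) - 1) * ∫ τ in (0 : ℝ)..t, b (k - 1) τ ^ 2 * |a k τ| := by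
      simp only [hA]
      exact intervalIntegral.integral_const_mul _ _
    rw [hint] at key
    simpa only [hE] using key

end Summit.NavierStokesRegularity.NavierStokesRegularity.Theorems.PerpetualPumpCircuitPump
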